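import Mathlib
import Summits.ResolutionOfSingularities.ResolutionOfSingularities.Theorems.SyzygyFlatteningDefs
import Literature.AlgebraicGeometry.Resolution.CompositeValuations
import HarnessLib

/-!
# Syzygy-flattening tower: a rank-one valuation ring is the ring of a real-valued valuation

Stub `stub_rankOne_realValued` of the crux `HigherRankTermination` (line `birth`, base-change
line, wave 2). The route measures "rank one" by overrings: `O ≠ ⊤` and the only valuation
subrings of `K` containing `O` are `O` and `⊤` (`TwoOverrings O`, equivalently
`ringKrullDim O = 1`). To run the Gauss-extension construction one needs an honest
`ℝ≥0`-valued valuation `v` of `K` with valuation ring `O`, non-trivial.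

Proof: the tree lemma `Literature.AlgebraicGeometry.Resolution.nonempty_rankOne_of_overrings`
gives Mathlib's `O.valuation.RankOne` (the value group is archimedean, hence embeds in `ℝ`);
its datum is a strictly monotone `e : ValueGroup₀ O.valuation →*₀ ℝ≥0`, and
`v := (O.valuation.restrict).map e` is the required valuation: `v x ≤ 1 ↔ O.valuation x ≤ 1 ↔
x ∈ O` by strict monotonicity, and any `x ∉ O` (there is one since `O ≠ ⊤`) has `1 < v x`.

Sources: rank one `⇔` archimedean value group `⇔` order-embedding into `ℝ` is
[Matsumura1987, §10, Thms. 10.6–10.7] / [ZariskiSamuel1960, VI §10]; folklore.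
-/

noncomputable section

-- single-problem summit: the doubled namespace component is forced
set_option linter.dupNamespace false

open scoped NNReal

namespace Summit.ResolutionOfSingularities.ResolutionOfSingularities.Theorems.SyzygyFlattening

/-- A valuation subring `O` of `K` whose valuation has rank one in Mathlib's sense
(`Valuation.RankOne`: a strictly monotone embedding of the value group into `ℝ≥0`) is the
valuation ring of an `ℝ≥0`-valued valuation of `K`; if moreover `O ≠ ⊤`, that valuation takes a
value `> 1`. [cite: Matsumura1987, §10 Thm. 10.7] -/
theorem exists_realValued_of_rankOne {K : Type*} [Field K] (O : ValuationSubring K)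
    (hr : O.valuation.RankOne) (hO : O ≠ ⊤) :
    ∃ v : Valuation K ℝ≥0, (∀ x : K, v x ≤ 1 ↔ x ∈ O) ∧ ∃ x : K, 1 < v x := by
  letI := hr
  have he : StrictMono (Valuation.RankOne.hom O.valuation) :=
    Valuation.RankOne.strictMono O.valuation
  have hle : ∀ x : K,
      (O.valuation.restrict.map (Valuation.RankOne.hom O.valuation) he.monotone) x ≤ 1 ↔
        x ∈ O := by
    intro x
    rw [Valuation.map_apply, ← O.valuation_le_one_iff,
      ← map_one (Valuation.RankOne.hom O.valuation), he.le_iff_le,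
      ← MonoidWithZeroHom.ValueGroup₀.embedding_strictMono.le_iff_le,
      Valuation.embedding_restrict, map_one]
  refine ⟨O.valuation.restrict.map (Valuation.RankOne.hom O.valuation) he.monotone, hle, ?_⟩
  obtain ⟨x, hxO⟩ : ∃ x, x ∉ O := by
    by_contra h
    push Not at h
    exact hO (eq_top_iff.mpr fun x _ => h x)
  exact ⟨x, lt_of_not_ge fun h => hxO ((hle x).mp h)⟩

/-- **Stub `stub_rankOne_realValued`.** A valuation ring `O ≠ ⊤` of `K` whose only overrings
are `O` and `⊤` (rank one, `TwoOverrings O`) is the valuation ring of a non-trivial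
`ℝ≥0`-valued valuation `v` of `K`: `v x ≤ 1 ↔ x ∈ O` for all `x`, and `1 < v x` for some `x`.
(The archimedean value group embeds into `ℝ`: tree lemma
`Literature.AlgebraicGeometry.Resolution.nonempty_rankOne_of_overrings`.)
[cite: ZariskiSamuel1960, VI §10] -/
theorem stub_rankOne_realValued : ∀ (K : Type) [Field K] (O : ValuationSubring K),
    O ≠ ⊤ → TwoOverrings O →
      ∃ v : Valuation K ℝ≥0, (∀ x : K, v x ≤ 1 ↔ x ∈ O) ∧ ∃ x : K, 1 < v x := by
  intro K _ O hO h2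
  obtain ⟨hr⟩ :=
    Literature.AlgebraicGeometry.Resolution.nonempty_rankOne_of_overrings O hO h2
  exact exists_realValued_of_rankOne O hr hO

end Summit.ResolutionOfSingularities.ResolutionOfSingularities.Theorems.SyzygyFlattening

end
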